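import Literature.Computability.QuantumComplexity.UniformSubstitution
import Literature.Computability.QuantumComplexity.PromiseBQPGateSetIndependence
import Literature.Computability.Complexity.CodeFPBudgets
import HarnessLib

/-!
# Substitution at logarithmic accuracy level, along an exponential-time compiler

Sequel of `UniformSubstitution.lean` and `PromiseBQPGateSetIndependence.lean`, reducing the named fact
`PromiseBQPOver_eq_PromiseBQP` (gate-set independence of `PromiseBQP`, `JonesInBQPProofs.lean`) to the
existence of **sound exponential-time compilers** (`PromiseBQPOver_eq_PromiseBQP_of_expTime`) — the
shape delivered by the brute-force `ε`-net compiler of `EffectiveCompilation.lean`, which closes the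
fact. The point: a polynomial-size circuit of size `s` only needs accuracy `2⁻ᵗ/s` per gate
(Arora–Barak 2009, §10.3.8: "such `ε`-approximation for, say, `ε < 1/10T` suffices"), i.e. accuracy
LEVEL `ℓ_t(s) = ⌊log₂ s⌋ + t + 1`, and a compiler that produces its level-`k` word in time `poly(2ᵏ)`
(polynomial in the inverse accuracy, as a net construction is — as opposed to the `polylog(1/ε)` of
the genuine Solovay–Kitaev recursion, `GateCompiler.PolyTime`) is then still polynomial-time along
the family.

* `GateCompiler.ExpTime W` — for every gate `g`, `1ᴺ ↦ word ⌊log₂ N⌋ g` is computed on codes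
  (`CodeFP`, raw gate codes of `UniformSubstitution.lean`).
* `substFamilyLvl W ℓ F` — substitution at the size-dependent level `ℓ(size)`; oracle-freeness;
  statistics `|ΔPr| ≤ s · 2^{-ℓ s}` (`abs_acceptProbOn_substFamilyLvl_sub_le`, from
  `exists_implOn_substCircuit` of `BQPGateSetIndependence.lean`); with `logLvl t`,
  `s · 2^{-ℓ_t(s)} ≤ 2⁻ᵗ` and `2^{ℓ_t(s)} ≤ 2^{t+1}(s + 1)`.
* **Uniformity** (`GateCompiler.isUniform_substFamilyLvl`): by the transducer `codeFP_substRawDesc`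
  of `UniformSubstitution.lean` fed with the word table of level `ℓ(size)`; along an `ExpTime`
  compiler the words of level `ℓ_t(s)` are computed on codes from `1ˢ` (`codeFP_two_pow_logLvl`:
  `⌊log₂ s⌋` by the capped doubling scan `natLog2Min`, the power by `natPow`, unary under the budget
  `2^{t+1}(s+1)`; `ExpTime.codeFP_word_logLvl`).
* **Classes**: `PromiseBQPWith_subset_of_expTime` (`PromiseBQPWith G₁ ε ⊆ PromiseBQPWith G₂ (ε + η)`),
  `PromiseBQPOver_eq_PromiseBQP_of_expTimeCompilers` (compilers both ways + promise error reduction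
  `PromiseBQPWith_eq_PromiseBQP`), **`PromiseBQPOver_eq_PromiseBQP_of_expTime`**.

Everything is proved; no named facts.

## References

* S. Arora, B. Barak, *Computational Complexity: A Modern Approach*, CUP 2009, Def. 10.9, §10.3.8,
  Exercise 10.8; §1.3, §6.2 [AroraBarak2009].
* M. A. Nielsen, I. L. Chuang, *Quantum Computation and Quantum Information*, CUP 2010, §4.5.3
  (eqs. (4.61)–(4.63)), §4.5.5 [NielsenChuang2010].
* C. M. Dawson, M. A. Nielsen, *The Solovay–Kitaev algorithm*, Quantum Inf. Comput. 6 (2006), §5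
  [DawsonNielsen2006].
* J. Watrous, *Quantum computational complexity*, arXiv:0804.3401 (2009), Def. 2, Prop. 3 [Watrous2009].
* E. Bernstein, U. Vazirani, *Quantum complexity theory*, SIAM J. Comput. 26 (1997), §6, §8
  [BernsteinVazirani1997].
-/

noncomputable section

namespace Literature.Computability.QuantumComplexity

open _root_.Computability Complexity Complexity.CodeFP Cryptography

variable {G₁ G₂ : QGateSet}

/-! ### Exponential-time compilers -/

/-- A gate compiler is **exponential-time** (in the accuracy level; i.e. polynomial-time in the
inverse accuracy `2ᵏ`) if for every gate `g` the map `1ᴺ ↦ word ⌊log₂ N⌋ g` is computed on codes by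
an `FP` string function: the word of level `k` (accuracy `2⁻ᵏ`) is available in time `poly(2ᵏ)`.
This is the efficiency of a brute-force `ε`-net compiler (time `poly(1/ε)`), as opposed to the
`polylog(1/ε)` of the genuine Solovay–Kitaev algorithm (`GateCompiler.PolyTime`); it suffices for
gate-set independence because a polynomial-size circuit only needs accuracy `1/poly` per gate
(`substFamilyLvl` with `logLvl`). [cite: DawsonNielsen2006, §5 (the initial ε-net)] -/
structure GateCompiler.ExpTime [Encodable G₂.Op] (W : GateCompiler G₁ G₂) : Prop where
  /-- the word of level `⌊log₂ N⌋` is computed on codes from `1ᴺ` -/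
  expTime : ∀ g, CodeFP unE (rawE RawGate.E) fun N => (W.word (Nat.log 2 N) g).rawGates

/-- **An exponential-time compiler in the `TM2` vocabulary of `GateCompiler.PolyTime`**: the word of
level `⌊log₂ N⌋` is polynomial-time computable from `1ᴺ` under `QCircuit.encode` (the raw-list code of
the raw gates IS the circuit code, `QCircuit.encode_eq_rawE`). [cite: AroraBarak2009, §1.3] -/
theorem GateCompiler.ExpTime.polyTimeComputable [Encodable G₂.Op] {W : GateCompiler G₁ G₂} (hW : W.ExpTime)
    (g : G₁.Op) : PolyTimeComputable unaryEncodeNat (QCircuit.encode (G := G₂)) fun N => W.word (Nat.log 2 N) g :=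
  ((hW.expTime g).recodeOut (eγ := fun C : QCircuit G₂ _ => C.encode) (g' := fun N => W.word (Nat.log 2 N) g)
    fun _ => (QCircuit.encode_eq_rawE _).symm).polyTimeComputable

/-! ### Substitution at a size-dependent level -/

section Lvl

variable (W : GateCompiler G₁ G₂) (ℓ : ℕ → ℕ)

/-- **The substituted family at level `ℓ(size)`**: on inputs of length `n` the circuit `F.circ n`
of size `s` is substituted at accuracy level `ℓ s` (scratch block after the ancillas).
[cite: NielsenChuang2010, §4.5.3] -/
def substFamilyLvl (F : QCircuitFamily G₁) : QCircuitFamily G₂ where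
  ancillas n := F.ancillas n + W.scratch
  circ n := mapWires (assocEmb n (F.ancillas n) W.scratch) (substCircuit W (ℓ (F.circ n).size) (F.circ n))

/-- Substituted families of oracle-free families along compilers with oracle-free words are
oracle-free. [folklore] -/
theorem isOracleFree_substFamilyLvl (hW : ∀ k g, (W.word k g).IsOracleFree) {F : QCircuitFamily G₁}
    (hF : F.IsOracleFree) : (substFamilyLvl W ℓ F).IsOracleFree :=
  fun n => isOracleFree_mapWires _ (isOracleFree_substCircuit W _ hW (hF n))

/-- **The substituted family has almost the same acceptance probabilities**: for a sound
compiler between unitary gate sets, `|Pr[substFamilyLvl W ℓ F accepts x] − Pr[F accepts x]| ≤ s · 2^{-ℓ s}`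
for the size `s` of the circuit run on `x` (errors add along the `s` substituted gates).
[cite: NielsenChuang2010, §4.5.3 eqs. (4.62)–(4.63)] -/
theorem abs_acceptProbOn_substFamilyLvl_sub_le (hW : W.Sound) (hG₁ : G₁.IsUnitary) (hG₂ : G₂.IsUnitary)
    (F : QCircuitFamily G₁) (A : Language Bool) (x : List Bool) :
    |(substFamilyLvl W ℓ F).acceptProbOn A x - F.acceptProbOn A x| ≤
      (F.circ x.length).size * (1 / 2 : ℝ) ^ ℓ (F.circ x.length).size := by
  set n := x.length with hn
  set s := (F.circ n).size with hs
  obtain ⟨c, hc, himpl⟩ := exists_implOn_substCircuit W (ℓ s) hW hG₁ hG₂ A (F.circ n)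
  have hD : ((substFamilyLvl W ℓ F).circ n).toMatrix A =
      placeGate (assocEmb n (F.ancillas n) W.scratch) ((substCircuit W (ℓ s) (F.circ n)).toMatrix A) := by
    change (mapWires (assocEmb n (F.ancillas n) W.scratch)
      (substCircuit W (ℓ (F.circ n).size) (F.circ n))).toMatrix A = _
    rw [toMatrix_mapWires]
  have himpl' : ImplOn Set.univ (((substFamilyLvl W ℓ F).circ n).toMatrix A)
      (c • placeGate (origEmb n (F.ancillas n) W.scratch) ((F.circ n).toMatrix A))
      (s * (1 / 2 : ℝ) ^ ℓ s) := by
    rw [hD, origEmb, ← placeGate_placeGate, ← placeGate_smul]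
    exact (himpl.placeGate _ (by positivity)).of_subset fun _ _ => Set.mem_univ _
  exact abs_acceptProb_sub_le_of_implOn (F.circ n) ((substFamilyLvl W ℓ F).circ n) A x.get hc
    (QCircuit.toMatrix_mem_unitaryGroup_holds hG₁ A _)
    (QCircuit.toMatrix_mem_unitaryGroup_holds hG₂ A _) himpl'

end Lvl

/-! ### The logarithmic level -/

/-- **The logarithmic accuracy level** `ℓ_t(s) = ⌊log₂ s⌋ + t + 1`: accuracy `2^{-ℓ} < 2⁻ᵗ / s` per
gate, so that a circuit of size `s` is compiled with total error `< 2⁻ᵗ`, while `2^{ℓ} ≤ 2^{t+1} s`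
stays polynomial. [cite: AroraBarak2009, §10.3.8 ("ε < 1/10T suffices")] -/
def logLvl (t s : ℕ) : ℕ := Nat.log 2 s + t + 1

/-- `s · 2^{-ℓ_t(s)} ≤ 2⁻ᵗ`. [folklore] -/
theorem size_mul_half_pow_logLvl_le (t s : ℕ) : (s : ℝ) * (1 / 2 : ℝ) ^ logLvl t s ≤ (1 / 2 : ℝ) ^ t := by
  have hs : (s : ℝ) < 2 ^ (Nat.log 2 s + 1) := by exact_mod_cast Nat.lt_pow_succ_log_self one_lt_two s
  rw [logLvl, show Nat.log 2 s + t + 1 = (Nat.log 2 s + 1) + t by ring, pow_add, ← mul_assoc]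
  refine mul_le_of_le_one_left (by positivity) ?_
  rw [one_div, inv_pow, mul_inv_le_iff₀ (by positivity), one_mul]
  exact hs.le

/-- `2^{ℓ_t(s)} ≤ 2^{t+1} (s + 1)`. [folklore] -/
theorem two_pow_logLvl_le (t s : ℕ) : 2 ^ logLvl t s ≤ 2 ^ (t + 1) * (s + 1) := by
  rw [logLvl, show Nat.log 2 s + t + 1 = (t + 1) + Nat.log 2 s by ring, pow_add]
  refine Nat.mul_le_mul_left _ ?_
  rcases Nat.eq_zero_or_pos s with rfl | hs
  · simp
  · exact (Nat.pow_log_le_self 2 hs.ne').trans (Nat.le_succ s)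

/-! ### Uniformity at a size-dependent level -/

section Uniform

variable [Encodable G₁.Op] [Encodable G₂.Op] (W : GateCompiler G₁ G₂) (ℓ : ℕ → ℕ)

/-- **The raw description of the family substituted at level `ℓ(size)`** is the raw substitution
along the word table of level `ℓ(size)`. [cite: NielsenChuang2010, §4.5.3] -/
theorem rawDesc_substFamilyLvl {M : ℕ} (hM : ∀ g : G₁.Op, Encodable.encode g ≤ M) (F : QCircuitFamily G₁) (n : ℕ) :
    (substFamilyLvl W ℓ F).rawDesc n = substRawDesc W.scratch 0 (fun s => W.wordTable M (ℓ s)) (F.rawDesc n) := by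
  simp only [QCircuitFamily.rawDesc, substRawDesc, QCircuit.length_rawGates, Nat.add_zero]
  refine Prod.ext rfl (Prod.ext rfl ?_)
  change (mapWires (assocEmb n (F.ancillas n) W.scratch)
    (substCircuit W (ℓ (F.circ n).size) (F.circ n))).rawGates = _
  rw [← rawGates_substCircuit W hM, QCircuit.rawGates, gates_mapWires, List.map_map, QCircuit.rawGates]
  exact List.map_congr_left fun γ _ => toRaw_mapWiresGate_assocEmb n (F.ancillas n) W.scratch γ

/-- The entries of the word table at level `ℓ(s)` are computed on codes when the words are. [folklore] -/
theorem GateCompiler.codeFP_tableEntry_lvl (hW : ∀ g, CodeFP unE (rawE RawGate.E) fun s => (W.word (ℓ s) g).rawGates)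
    (c : ℕ) : CodeFP unE (rawE RawGate.E) fun s => W.tableEntry (ℓ s) c := by
  unfold GateCompiler.tableEntry
  cases Encodable.decode (α := G₁.Op) c with
  | none => exact CodeFP.const unE []
  | some g => exact hW g

/-- **The word table at level `ℓ(s)` is computed on codes** when the words of level `ℓ(s)` are. [folklore] -/
theorem GateCompiler.codeFP_wordTable_lvl (hW : ∀ g, CodeFP unE (rawE RawGate.E) fun s => (W.word (ℓ s) g).rawGates)
    (M : ℕ) : CodeFP unE (rawE (rawE RawGate.E)) fun s => W.wordTable M (ℓ s) :=
  codeFP_map_list (W.codeFP_tableEntry_lvl ℓ hW) (List.range (M + 1))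

/-- **Uniformity of substitution at level `ℓ(size)`**: if the words of level `ℓ(s)` are computed on
codes from `1ˢ`, substituting a uniform family at level `ℓ(size)` gives a uniform family.
[cite: AroraBarak2009, §10.3.8 and Exercise 10.8; §6.2 and §1.3] -/
theorem GateCompiler.isUniform_substFamilyLvl [Finite G₁.Op]
    (hW : ∀ g, CodeFP unE (rawE RawGate.E) fun s => (W.word (ℓ s) g).rawGates)
    {F : QCircuitFamily G₁} (hF : F.IsUniform) : (substFamilyLvl W ℓ F).IsUniform := by
  obtain ⟨M, hM⟩ := (Set.finite_range fun g : G₁.Op => Encodable.encode g).bddAbove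
  have hM' : ∀ g : G₁.Op, Encodable.encode g ≤ M := fun g => hM ⟨g, rfl⟩
  rw [QCircuitFamily.isUniform_iff_descFn_mem_FP] at hF ⊢
  obtain ⟨S, hS, hSe⟩ := codeFP_substRawDesc W.scratch 0 (W.codeFP_wordTable_lvl ℓ hW M)
  have h : (substFamilyLvl W ℓ F).descFn = S ∘ F.descFn := funext fun z => by
    rw [Function.comp_apply, QCircuitFamily.descFn_eq_E_rawDesc, QCircuitFamily.descFn_eq_E_rawDesc, hSe,
      rawDesc_substFamilyLvl W ℓ hM']
  rw [h]
  exact comp_mem_FP hS hF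

end Uniform

/-! ### Words of logarithmic level are computed on codes along an exponential-time compiler -/

section LogWords

/-- Multiplication of a unary numeral by a constant. [folklore] -/
theorem codeFP_unMulConst : ∀ c : ℕ, CodeFP unE unE fun n => c * n
  | 0 => (CodeFP.const unE 0).congr fun n => by simp
  | c + 1 => (unAdd.comp ((codeFP_unMulConst c).pair (CodeFP.id unE))).congr fun n => by
      simp only [id]; ring

/-- **`1ˢ ↦ 1^{2^{ℓ_t(s)}}` is computed on codes**: `⌊log₂ s⌋` by the capped doubling scan
(`natLog2Min`), the power by `natPow` on a unary exponent, and the result converted to unary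
under the budget `2^{t+1}(s + 1)`. [cite: AroraBarak2009, §1.3] -/
theorem codeFP_two_pow_logLvl (t : ℕ) : CodeFP unE unE fun s => 2 ^ logLvl t s := by
  -- `⌊log₂ s⌋` in binary
  have hlog : CodeFP unE natE fun s => Nat.log 2 s :=
    (natLog2Min.comp (natOfUn.pair replicateUnit)).congr fun s => by
      simp only [id, List.length_replicate]; exact min_eq_right (Nat.log_le_self 2 s)
  -- the exponent `⌊log₂ s⌋ + t + 1` in binary, then in unary under the budget `s + t + 1`
  have hexp : CodeFP unE natE fun s => logLvl t s := (natAdd.comp (hlog.pair (const _ (t + 1)))).congr fun s => by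
    simp only [logLvl]; ring
  have hbud : CodeFP unE unE fun s => s + (t + 1) := unAdd.comp ((CodeFP.id unE).pair (const _ (t + 1)))
  have hexpU : CodeFP unE unE fun s => logLvl t s :=
    (unOfNatMin.comp (hbud.pair hexp)).congr fun s => by
      refine min_eq_left ?_
      simp only [logLvl]
      have := Nat.log_le_self 2 s
      omega
  -- the power in binary
  have hpow : CodeFP unE natE fun s => 2 ^ logLvl t s := natPow.comp ((const _ 2).pair hexpU)
  -- to unary under the budget `2^{t+1} (s + 1)`
  have hbud2 : CodeFP unE unE fun s => 2 ^ (t + 1) * (s + 1) := (codeFP_unMulConst (2 ^ (t + 1))).comp unSucc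
  exact (unOfNatMin.comp (hbud2.pair hpow)).congr fun s => min_eq_left (two_pow_logLvl_le t s)

variable [Encodable G₂.Op] (W : GateCompiler G₁ G₂)

/-- **Along an exponential-time compiler the words of logarithmic level are computed on codes**
from the unary size. [cite: AroraBarak2009, §1.3] -/
theorem GateCompiler.ExpTime.codeFP_word_logLvl (hW : W.ExpTime) (t : ℕ) (g : G₁.Op) :
    CodeFP unE (rawE RawGate.E) fun s => (W.word (logLvl t s) g).rawGates :=
  ((hW.expTime g).comp (codeFP_two_pow_logLvl t)).congr fun s => by
    simp only [Nat.log_pow one_lt_two]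

end LogWords

/-! ### Class level -/

section Classes

variable [Encodable G₁.Op] [Encodable G₂.Op]

/-- **Compilation along a sound exponential-time compiler moves promise classes by an arbitrarily
small error**: `PromiseBQPWith G₁ ε ⊆ PromiseBQPWith G₂ (ε + η)` for every `η > 0` — substitute at the
logarithmic level `ℓ_t(size)` with `2⁻ᵗ < η` (the substituted family is uniform by
`isUniform_substFamilyLvl`, its statistics move by `≤ size · 2^{-ℓ} ≤ 2⁻ᵗ`).
[cite: NielsenChuang2010, §4.5.3] [cite: AroraBarak2009, §10.3.8] -/
theorem PromiseBQPWith_subset_of_expTime [Finite G₁.Op] (hG₁ : G₁.IsUnitary) (hG₂ : G₂.IsUnitary)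
    (W : GateCompiler G₁ G₂) (hW : W.Sound) (hWe : W.ExpTime) (ε : ℝ) {η : ℝ} (hη : 0 < η) :
    PromiseBQPWith G₁ ε ⊆ PromiseBQPWith G₂ (ε + η) := by
  rintro Q ⟨F, hfree, hunif, hyes, hno⟩
  obtain ⟨t, ht⟩ := exists_pow_lt_of_lt_one hη (by norm_num : (1 / 2 : ℝ) < 1)
  have hbound : ∀ x, |(substFamilyLvl W (logLvl t) F).acceptProbOn 0 x - F.acceptProbOn 0 x| ≤ (1 / 2 : ℝ) ^ t :=
    fun x => (abs_acceptProbOn_substFamilyLvl_sub_le W (logLvl t) hW hG₁ hG₂ F 0 x).trans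
      (size_mul_half_pow_logLvl_le t _)
  refine ⟨substFamilyLvl W (logLvl t) F, isOracleFree_substFamilyLvl W (logLvl t) hW.isOracleFree hfree,
    W.isUniform_substFamilyLvl (logLvl t) (hWe.codeFP_word_logLvl W t) hunif, fun x hx => ?_, fun x hx => ?_⟩
  · have h := hbound x
    rw [abs_le] at h
    have := hyes x hx
    linarith [h.1]
  · have h := hbound x
    rw [abs_le] at h
    have := hno x hx
    linarith [h.2]

/-- **Gate-set independence of `PromiseBQP` from sound exponential-time compilers both ways**
(with error reduction for the promise class, `PromiseBQPWith_eq_PromiseBQP`).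
[cite: NielsenChuang2010, §4.5.3 and §4.5.5] [cite: Watrous2009, Prop. 3] -/
theorem PromiseBQPOver_eq_PromiseBQP_of_expTimeCompilers (G : QGateSet) [Finite G.Op] [Encodable G.Op]
    (hG : G.IsUnitary) (W₁ : GateCompiler cliffordT G) (h₁ : W₁.Sound) (he₁ : W₁.ExpTime)
    (W₂ : GateCompiler G cliffordT) (h₂ : W₂.Sound) (he₂ : W₂.ExpTime) :
    PromiseBQPOver G = PromiseBQP := by
  apply Set.Subset.antisymm
  · intro Q hQ
    rw [← PromiseBQPWith_one_third] at hQ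
    have h := PromiseBQPWith_subset_of_expTime hG cliffordT_isUnitary_holds W₂ h₂ he₂ (1 / 3)
      (by norm_num : (0 : ℝ) < 1 / 12) hQ
    rwa [PromiseBQPWith_eq_PromiseBQP (ε := 1 / 3 + 1 / 12) (by norm_num) (by norm_num)] at h
  · intro Q hQ
    rw [← PromiseBQPWith_eq_PromiseBQP (ε := 1 / 6) (by norm_num) (by norm_num)] at hQ
    have h := PromiseBQPWith_subset_of_expTime cliffordT_isUnitary_holds hG W₁ h₁ he₁ (1 / 6)
      (by norm_num : (0 : ℝ) < 1 / 6) hQ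
    have e : (1 / 6 : ℝ) + 1 / 6 = 1 / 3 := by norm_num
    rw [e, PromiseBQPWith_one_third] at h
    exact h

/-- **Reduction of the named fact `PromiseBQPOver_eq_PromiseBQP` to the existence of sound
exponential-time compilers** (the brute-force `ε`-net compiler of the sequel files): into any
finite, unitary, inverse-closed, placement-universal gate set with polynomial-time computable
entries, every finite unitary gate set with polynomial-time computable entries is compiled by a
sound `GateCompiler` whose words of level `k` are computed in time `poly(2ᵏ)`. Everything else —
error reduction for the promise class, universality, unitarity, inverse-closedness and
polynomial-time entries of Clifford+`T` — is taken from the tree.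
[cite: DawsonNielsen2006, Thm. 1 and §5] [cite: BernsteinVazirani1997, §6 and §8] [cite: Watrous2009, Prop. 3] -/
theorem PromiseBQPOver_eq_PromiseBQP_of_expTime
    (hC : ∀ (G₁ G₂ : QGateSet) [Finite G₁.Op] [Encodable G₁.Op] [Finite G₂.Op] [Encodable G₂.Op],
      G₁.IsUnitary →
      (∀ (g : G₁.Op) (i j : QReg (G₁.arity g)), G₁.mat g i j ∈ polyTimeComputableComplex) →
      G₂.IsUnitary → G₂.IsUniversal → G₂.IsInverseClosed →
      (∀ (g : G₂.Op) (i j : QReg (G₂.arity g)), G₂.mat g i j ∈ polyTimeComputableComplex) →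
      ∃ W : GateCompiler G₁ G₂, W.Sound ∧ W.ExpTime) :
    PromiseBQPOver_eq_PromiseBQP := by
  intro G _ _ hGU huniv hinv hcomp
  obtain ⟨W₁, h₁, e₁⟩ :=
    hC cliffordT G cliffordT_isUnitary_holds cliffordT_polyTimeEntries hGU huniv hinv hcomp
  obtain ⟨W₂, h₂, e₂⟩ := hC G cliffordT hGU hcomp cliffordT_isUnitary_holds cliffordT_isUniversal_holds
    cliffordT_isInverseClosed cliffordT_polyTimeEntries
  exact PromiseBQPOver_eq_PromiseBQP_of_expTimeCompilers G hGU W₁ h₁ e₁ W₂ h₂ e₂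

end Classes

end Literature.Computability.QuantumComplexity

end
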